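import Mathlib
import Summits.ResolutionOfSingularities.ResolutionOfSingularities.Theorems.WeightedInvariantLocalWeightedDropTOT2NearDir

/-!
# `WeightedInvariant.LocalWeightedDrop`, TOT₂ line (skeleton v32, residual `stub_spaceNCRankDrop`), piece S-NEAR part 5:
# THE DIRECTRIX WITH HISTORY — `Dir(in(f · ∏_{l ∈ O} X_l)) = Dir(in f) ∩ ⋂_{l ∈ O} {u_l = 0}` (the `I₃`-device read on initial forms)

Crux item stmt-ResolutionOfSingularities-8899 `LocalWeightedDrop`; sub-line TOT2-LINE v1/v1.1 (`L/res-L1-w43-lead-1/g4/TOT2-LINE.md`) §4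
(«with history: x′ O-near ⇒ x′ ∈ ℙ(Dir^O_x)», «e^O_{x′} ≤ e^O_x») with v1.1 (B) (the I₃-device `f̃ := f · ∏_{h ∈ O} h`) and res-L1-w43-strat-1's
CRITIQUE-TOT2-v1 (P) («Dir^O = Dir(in g)» for `g = f · ∏_{l ∈ O(x)} X_l`).  [OURS · L1 W4.3, chain w43, res-L1-w43-stub-3 (gen 4) = S-NEAR hand.
MODEL: Cossart–Jannsen–Saito, LNM 2270, Def. 3.? `e^O_x(X) := dim (Dir_x(X) ∩ ⋂_{B ∈ O(x)} T_x(B))` (corpus p0042 ff.).  AI-written; gate-accepted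
means sorry-free with standard axioms, not refereed.  Def-free.]

With the OLD COMPONENTS `{X_l = 0}`, `l ∈ O`, multiplied into the equation (`f̃ = f · ∏_{l ∈ O} X_l`, order `o + |O|`), the near-point theory of
parts 1–4 applies to `f̃` verbatim; this file says what its directrix is:
* `initForm_mul_X`, `initEval_mul_X`, `initEval_mul_prod_X` — `in_{o+|O|}(f · ∏ X_l) = in_o(f) · ∏ X_l` (as polynomials / as functions; no
  hypothesis: `∏ X_l` is homogeneous).
* `inv_mul_prod_X` — `Dir(in f) ∩ ⋂_{l∈O} {u_l = 0} ⊆ Dir(in f̃)` (every field).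
* `apply_eq_zero_of_inv_mul_prod_X`, `inv_of_inv_mul_prod_X`, **`inv_mul_prod_X_iff`** — equality, over a field with infinitely many elements
  and for `o = ord f` (so that `in_o f ≠ 0`): an invariance vector `u` of `in f̃` has `u_l = 0` on `O` (else `in f̃`, vanishing on `{x_l = 0}` and
  invariant along `u`, vanishes everywhere) and then is one of `in f` (cancel `∏ x_l` from the polynomial identity).
* **`near_old`** — (N1) WITH HISTORY: an `O`-near point `c` of the point blow-up (near for `f̃`) lies on `ℙ(Dir(in f))` AND on every old
  component: `c ∈ Dir(in f)`, `c_l = 0` for `l ∈ O` (CJS Lemma 3.14/Thm 3.18-type statement in hypersurface form).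
-/

set_option linter.dupNamespace false -- mandated namespace of this single-conjunct summit
set_option autoImplicit false

namespace Summit.ResolutionOfSingularities.ResolutionOfSingularities.Theorems

namespace TOT2Near

open MvPowerSeries Literature.AlgebraicGeometry.Resolution

variable {k : Type} [Field k] {N : ℕ}

/-! ## §1 The initial form of `f · ∏ X_l` -/

/-- `in_{o+1}(g · X_a) = in_o(g) · X_a` as polynomials. -/
theorem initForm_mul_X (g : MvPowerSeries (Fin N) k) (a : Fin N) (o : ℕ) :
    (∑ e ∈ (Finset.univ : Finset (Fin N)).finsuppAntidiag (o + 1), MvPolynomial.monomial e (coeff e (g * X a)) :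
        MvPolynomial (Fin N) k) =
      (∑ e ∈ (Finset.univ : Finset (Fin N)).finsuppAntidiag o, MvPolynomial.monomial e (coeff e g)) * MvPolynomial.X a := by
  classical
  refine MvPolynomial.ext _ _ fun β => ?_
  rw [ApexFreeOrderDrop.coeff_initForm, MvPolynomial.coeff_mul_X', ApexFreeOrderDrop.coeff_initForm, X_def, coeff_mul_monomial]
  simp only [ApexFreeOrderDrop.mem_antidiag_iff, ApexFreeOrderDrop.weight_one_eq_degree]
  by_cases ha : a ∈ β.support
  · have hle : Finsupp.single a 1 ≤ β :=
      Finsupp.single_le_iff.mpr (Nat.one_le_iff_ne_zero.mpr (Finsupp.mem_support_iff.mp ha))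
    have hdeg : β.degree = (β - Finsupp.single a 1).degree + 1 := by
      conv_lhs => rw [← tsub_add_cancel_of_le hle]
      rw [map_add, Finsupp.degree_single]
    rw [if_pos ha, if_pos hle, mul_one, hdeg]
    by_cases h : (β - Finsupp.single a 1).degree = o
    · rw [if_pos h, if_pos (by omega)]
    · rw [if_neg h, if_neg (by omega)]
  · have hnle : ¬ Finsupp.single a 1 ≤ β := fun h =>
      ha (Finsupp.mem_support_iff.mpr (Nat.one_le_iff_ne_zero.mp (Finsupp.single_le_iff.mp h)))
    rw [if_neg ha, if_neg hnle]
    split_ifs <;> rfl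

/-- `in_{o+1}(g · X_a)(v) = in_o(g)(v) · v_a`. -/
theorem initEval_mul_X (g : MvPowerSeries (Fin N) k) (a : Fin N) (o : ℕ) (v : Fin N → k) :
    CobordantChart.initEval (fun _ : Fin N => 1) v (o + 1) (g * X a) = CobordantChart.initEval (fun _ : Fin N => 1) v o g * v a := by
  rw [← ApexFreeOrderDrop.eval_initForm, initForm_mul_X, map_mul, MvPolynomial.eval_X, ApexFreeOrderDrop.eval_initForm]

/-- **`in_{o+|O|}(g · ∏_{l∈O} X_l)(v) = in_o(g)(v) · ∏_{l∈O} v_l`** — the initial form of the equation with the old components multiplied in. -/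
theorem initEval_mul_prod_X (g : MvPowerSeries (Fin N) k) (O : Finset (Fin N)) (o : ℕ) (v : Fin N → k) :
    CobordantChart.initEval (fun _ : Fin N => 1) v (o + O.card) (g * ∏ l ∈ O, X l) =
      CobordantChart.initEval (fun _ : Fin N => 1) v o g * ∏ l ∈ O, v l := by
  classical
  induction O using Finset.induction_on with
  | empty => rw [Finset.prod_empty, Finset.prod_empty, mul_one, mul_one, Finset.card_empty, add_zero]
  | insert a O ha ih =>
    rw [Finset.prod_insert ha, Finset.prod_insert ha, mul_comm (X a) _, ← mul_assoc, Finset.card_insert_of_notMem ha, ← add_assoc,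
      initEval_mul_X, ih]
    ring

/-! ## §2 `Dir(in f) ∩ ⋂_{l∈O} {u_l = 0} ⊆ Dir(in f̃)` -/

/-- An invariance vector of `in_o f` vanishing on the old letters is an invariance vector of `in_{o+|O|}(f · ∏_{l∈O} X_l)`. -/
theorem inv_mul_prod_X {o : ℕ} {f : MvPowerSeries (Fin N) k} {u : Fin N → k} (O : Finset (Fin N))
    (hu : ∀ v, CobordantChart.initEval (fun _ : Fin N => 1) (v + u) o f = CobordantChart.initEval (fun _ : Fin N => 1) v o f)
    (hO : ∀ l ∈ O, u l = 0) (v : Fin N → k) :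
    CobordantChart.initEval (fun _ : Fin N => 1) (v + u) (o + O.card) (f * ∏ l ∈ O, X l) =
      CobordantChart.initEval (fun _ : Fin N => 1) v (o + O.card) (f * ∏ l ∈ O, X l) := by
  rw [initEval_mul_prod_X, initEval_mul_prod_X, hu v]
  congr 1
  exact Finset.prod_congr rfl fun l hl => by rw [Pi.add_apply, hO l hl, add_zero]

/-! ## §3 `Dir(in f̃) ⊆ Dir(in f) ∩ ⋂_{l∈O} {u_l = 0}` (infinite field, `o = ord f`) -/

/-- The initial form polynomial of a germ of finite order `o` is non-zero. -/
theorem initForm_ne_zero_of_order_eq {o : ℕ} {f : MvPowerSeries (Fin N) k} (hord : f.order = o) :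
    (∑ e ∈ (Finset.univ : Finset (Fin N)).finsuppAntidiag o, MvPolynomial.monomial e (coeff e f) : MvPolynomial (Fin N) k) ≠ 0 := by
  classical
  intro hF
  have hfin : f.order.toNat = f.order := by rw [hord]; rfl
  obtain ⟨d, hd, hdeg⟩ := exists_coeff_ne_zero_and_order hfin
  rw [hord] at hdeg
  have hc := congr_arg (MvPolynomial.coeff d) hF
  rw [ApexFreeOrderDrop.coeff_initForm, if_pos (by
    rw [ApexFreeOrderDrop.mem_antidiag_iff, ApexFreeOrderDrop.weight_one_eq_degree]; exact_mod_cast hdeg),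
    MvPolynomial.coeff_zero] at hc
  exact hd hc

/-- The product of the old letters is a non-zero polynomial. -/
theorem prod_X_ne_zero (O : Finset (Fin N)) : (∏ l ∈ O, MvPolynomial.X l : MvPolynomial (Fin N) k) ≠ 0 :=
  Finset.prod_ne_zero_iff.mpr fun l _ => MvPolynomial.X_ne_zero l

/-- **AN INVARIANCE VECTOR OF `in f̃` IS TANGENT TO EVERY OLD COMPONENT**: for `o = ord f` over a field with infinitely many elements, an
invariance vector `u` of `in_{o+|O|}(f · ∏_{l∈O} X_l)` has `u_l = 0` for `l ∈ O` (else the form, which vanishes on `{x_l = 0}` and is invariant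
along the line `k · u` transversal to it, vanishes identically — but it is `in_o(f) · ∏ x_l ≠ 0`). -/
theorem apply_eq_zero_of_inv_mul_prod_X [Infinite k] {o : ℕ} {f : MvPowerSeries (Fin N) k} (hord : f.order = o)
    (O : Finset (Fin N)) {u : Fin N → k}
    (hu : ∀ v, CobordantChart.initEval (fun _ : Fin N => 1) (v + u) (o + O.card) (f * ∏ l ∈ O, X l) =
      CobordantChart.initEval (fun _ : Fin N => 1) v (o + O.card) (f * ∏ l ∈ O, X l))
    {l : Fin N} (hl : l ∈ O) : u l = 0 := by
  classical
  by_contra hul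
  -- the form of `f̃` vanishes identically
  have hG : ∀ x : Fin N → k, CobordantChart.initEval (fun _ : Fin N => 1) x (o + O.card) (f * ∏ l ∈ O, X l) = 0 := by
    intro x
    have hy : (x - (x l / u l) • u) l = 0 := by
      show x l - x l / u l * u l = 0
      rw [div_mul_cancel₀ _ hul, sub_self]
    rw [← sub_add_cancel x ((x l / u l) • u), inv_smul hu (x l / u l), initEval_mul_prod_X,
      Finset.prod_eq_zero hl hy, mul_zero]
  -- hence `in_o(f) · ∏ X_l = 0` as a polynomial
  have hP : (∑ e ∈ (Finset.univ : Finset (Fin N)).finsuppAntidiag o, MvPolynomial.monomial e (coeff e f) :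
      MvPolynomial (Fin N) k) * ∏ l ∈ O, MvPolynomial.X l = 0 := by
    refine MvPolynomial.funext fun x => ?_
    rw [map_mul, map_prod, ApexFreeOrderDrop.eval_initForm, map_zero]
    simp only [MvPolynomial.eval_X]
    rw [← initEval_mul_prod_X, hG]
  exact initForm_ne_zero_of_order_eq hord ((mul_eq_zero.mp hP).resolve_right (prod_X_ne_zero O))

/-- **… AND IS AN INVARIANCE VECTOR OF `in f`**: cancel `∏ x_l` from `(in_o f (x + u) − in_o f (x)) · ∏_{l∈O} x_l = 0`. -/
theorem inv_of_inv_mul_prod_X [Infinite k] {o : ℕ} {f : MvPowerSeries (Fin N) k} (hord : f.order = o)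
    (O : Finset (Fin N)) {u : Fin N → k}
    (hu : ∀ v, CobordantChart.initEval (fun _ : Fin N => 1) (v + u) (o + O.card) (f * ∏ l ∈ O, X l) =
      CobordantChart.initEval (fun _ : Fin N => 1) v (o + O.card) (f * ∏ l ∈ O, X l))
    (v : Fin N → k) :
    CobordantChart.initEval (fun _ : Fin N => 1) (v + u) o f = CobordantChart.initEval (fun _ : Fin N => 1) v o f := by
  classical
  have hul : ∀ l ∈ O, u l = 0 := fun l hl => apply_eq_zero_of_inv_mul_prod_X hord O hu hl
  have hP : ((∑ e ∈ (Finset.univ : Finset (Fin N)).finsuppAntidiag o,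
        MvPolynomial.C (coeff e f) * ∏ i, (MvPolynomial.C (u i) + MvPolynomial.X i) ^ (e i)) -
      ∑ e ∈ (Finset.univ : Finset (Fin N)).finsuppAntidiag o, MvPolynomial.monomial e (coeff e f) : MvPolynomial (Fin N) k) *
      ∏ l ∈ O, MvPolynomial.X l = 0 := by
    refine MvPolynomial.funext fun x => ?_
    rw [map_mul, map_sub, map_prod, ApexFreeOrderDrop.eval_translate, ApexFreeOrderDrop.eval_initForm, map_zero]
    simp only [MvPolynomial.eval_X]
    have h1 := hu x
    rw [initEval_mul_prod_X, initEval_mul_prod_X,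
      Finset.prod_congr rfl fun l hl => by rw [Pi.add_apply, hul l hl, add_zero]] at h1
    rw [sub_mul, h1, sub_self]
  have h := congr_arg (MvPolynomial.eval v) (sub_eq_zero.mp ((mul_eq_zero.mp hP).resolve_right (prod_X_ne_zero O)))
  rwa [ApexFreeOrderDrop.eval_translate, ApexFreeOrderDrop.eval_initForm] at h

/-- **`Dir(in(f · ∏_{l∈O} X_l)) = Dir(in f) ∩ ⋂_{l∈O} {u_l = 0}`** (= CJS's `Dir^O`; `e^O = dim` of it ≤ `e`), over a field with infinitely many
elements and for `o = ord f`. -/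
theorem inv_mul_prod_X_iff [Infinite k] {o : ℕ} {f : MvPowerSeries (Fin N) k} (hord : f.order = o) (O : Finset (Fin N))
    (u : Fin N → k) :
    (∀ v, CobordantChart.initEval (fun _ : Fin N => 1) (v + u) (o + O.card) (f * ∏ l ∈ O, X l) =
      CobordantChart.initEval (fun _ : Fin N => 1) v (o + O.card) (f * ∏ l ∈ O, X l)) ↔
    (∀ v, CobordantChart.initEval (fun _ : Fin N => 1) (v + u) o f = CobordantChart.initEval (fun _ : Fin N => 1) v o f) ∧
      ∀ l ∈ O, u l = 0 :=
  ⟨fun hu => ⟨inv_of_inv_mul_prod_X hord O hu, fun _ hl => apply_eq_zero_of_inv_mul_prod_X hord O hu hl⟩,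
    fun h => inv_mul_prod_X O h.1 h.2⟩

/-! ## §4 (N1) with history -/

/-- **(N1) WITH HISTORY — AN `O`-NEAR POINT LIES ON `ℙ(Dir^O)`**: under the point move at the exceptional point `c` (live slot `i₀`) applied to
the equation with history `f̃ = f · ∏_{l∈O} X_l` (`f̃(s(c + y)) = s^{o+|O|} · G̃`), if the sliced strict transform of `f̃` still has order
`≥ o + |O|` (the new point is `O`-NEAR: same order AND on all old components), then `c` is an invariance vector of `in_o f` and `c_l = 0` for every
`l ∈ O`.  (Part 1's (N1) for `f̃`, read through `inv_mul_prod_X_iff`; `k` infinite, `o = ord f`.) -/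
theorem near_old [Infinite k] {n : ℕ} (f : MvPowerSeries (Fin (n + 1)) k) {o : ℕ} (hord : f.order = o) (O : Finset (Fin (n + 1)))
    (c : Fin (n + 1) → k) (i₀ : Fin (n + 1)) (hc : c i₀ ≠ 0) {G : MvPowerSeries (Fin (n + 1 + 1)) k}
    (hfac : subst (CobordantChart.chart (fun _ : Fin (n + 1) => 1) c) (f * ∏ l ∈ O, X l) = X 0 ^ (o + O.card) * G)
    (hnear : ((o + O.card : ℕ) : ℕ∞) ≤ (TupleGame.slice i₀ G).order) :
    (∀ (t : k) (v : Fin (n + 1) → k),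
      CobordantChart.initEval (fun _ : Fin (n + 1) => 1) (v + t • c) o f = CobordantChart.initEval (fun _ : Fin (n + 1) => 1) v o f) ∧
      ∀ l ∈ O, c l = 0 := by
  have h1 : ∀ v, CobordantChart.initEval (fun _ : Fin (n + 1) => 1) (v + c) (o + O.card) (f * ∏ l ∈ O, X l) =
      CobordantChart.initEval (fun _ : Fin (n + 1) => 1) v (o + O.card) (f * ∏ l ∈ O, X l) := fun v => by
    have h := initEval_add_smul_eq_of_near (f * ∏ l ∈ O, X l) c i₀ hc hfac hnear 1 v
    rwa [one_smul] at h
  obtain ⟨hinv, hO⟩ := (inv_mul_prod_X_iff hord O c).mp h1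
  exact ⟨fun t v => inv_smul hinv t v, hO⟩

/-! ## §5 Units do not change the directrix -/

/-- The degree-`0` form is the constant coefficient. -/
theorem initEval_zero_eq_constantCoeff (U : MvPowerSeries (Fin N) k) (v : Fin N → k) :
    CobordantChart.initEval (fun _ : Fin N => 1) v 0 U = constantCoeff U := by
  classical
  rw [ApexFreeOrderDrop.initEval_one_eq_sum, Finset.finsuppAntidiag_zero, Finset.sum_singleton, coeff_zero_eq_constantCoeff_apply,
    Finset.prod_eq_one (fun l _ => by rw [Finsupp.coe_zero, Pi.zero_apply, pow_zero]), mul_one]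

/-- **UNITS DO NOT CHANGE THE FORM** (up to the constant `U(0)`): if `o ≤ ord g` then `in_o(U · g)(v) = U(0) · in_o(g)(v)`
(`CobordantChart.initEval_mul`: the other products `in_{b₁}(U) · in_{b₂}(g)`, `b₂ < o`, vanish). -/
theorem initEval_mul_of_le_order (U g : MvPowerSeries (Fin N) k) {o : ℕ} (hg : (o : ℕ∞) ≤ g.order) (v : Fin N → k) :
    CobordantChart.initEval (fun _ : Fin N => 1) v o (U * g) = constantCoeff U * CobordantChart.initEval (fun _ : Fin N => 1) v o g := by
  rw [CobordantChart.initEval_mul (fun _ : Fin N => 1) v (fun _ h => absurd h one_ne_zero) U g o,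
    Finset.sum_eq_single (0, o)]
  · rw [initEval_zero_eq_constantCoeff]
  · rintro ⟨b₁, b₂⟩ hp hne
    rw [Finset.HasAntidiagonal.mem_antidiagonal] at hp
    have hb₂ : b₂ < o := by
      rcases Nat.lt_or_ge b₂ o with h | h
      · exact h
      · exfalso
        apply hne
        have h1 : b₁ = 0 := by simp only at hp; omega
        have h2 : b₂ = o := by simp only at hp; omega
        rw [h1, h2]
    have hlt : (b₂ : ℕ∞) < g.weightedOrder (fun _ : Fin N => 1) := lt_of_lt_of_le (by exact_mod_cast hb₂) hg
    rw [CobordantChart.initEval_eq_zero_of_lt (fun _ : Fin N => 1) v (fun _ h => absurd h one_ne_zero) g hlt, mul_zero]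
  · intro h
    exact absurd (Finset.HasAntidiagonal.mem_antidiagonal.mpr (zero_add o)) h

/-- **… HENCE `U · g` AND `g` HAVE THE SAME INVARIANCE VECTORS** (`U(0) ≠ 0`, `o ≤ ord g`): the directrix of the strict transform does not
depend on the unit by which two local equations differ (e.g. the factors `c_l + y_l`, `c_l ≠ 0`, of old components leaving the new point). -/
theorem inv_unit_mul_iff {U g : MvPowerSeries (Fin N) k} (hU : constantCoeff U ≠ 0) {o : ℕ} (hg : (o : ℕ∞) ≤ g.order)
    (u : Fin N → k) :
    (∀ v, CobordantChart.initEval (fun _ : Fin N => 1) (v + u) o (U * g) = CobordantChart.initEval (fun _ : Fin N => 1) v o (U * g)) ↔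
      ∀ v, CobordantChart.initEval (fun _ : Fin N => 1) (v + u) o g = CobordantChart.initEval (fun _ : Fin N => 1) v o g := by
  simp only [initEval_mul_of_le_order U g hg]
  exact ⟨fun h v => mul_left_cancel₀ hU (h v), fun h v => by rw [h v]⟩

end TOT2Near

end Summit.ResolutionOfSingularities.ResolutionOfSingularities.Theorems
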